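import Mathlib
import HarnessLib
import HarnessLib.Audit
import Summits.Langlands.Statement
import Summits.Langlands.Langlands.Theses.CoreAdequacySplit
import Summits.Langlands.Langlands.Theorems.CoreAdequacySplit
import Summits.Langlands.Langlands.Theorems.BrightMateBypass
import Literature.NumberTheory.GaloisRepresentations.ResidualGaloisRep
import Literature.NumberTheory.GaloisRepresentations.AdequateSubgroup
import Summits.Langlands.Langlands.Theses.LieDefectSplit

/-! # birth skeleton (BC3) of DEG = `LieDefectSplit.DegenerateLayerLifting` (DECLARED RESIDUAL; exempt from T3).
Pre-birth form: DEG declared locally VERBATIM (after birth conclude `Summit.Langlands.Langlands.Theses.LieDefectSplit.DegenerateLayerLifting`).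
Split by the SLAB: ℓ ∣ n (clause (ii) fails on every layer — tree `Subgroup.adZeroRep_invariants_ne_bot`; rows (2,2) [booked by the MinimalLevelDescent
lineage], (3,3), (4,2), (4,4)…) versus ℓ ∤ n (clause (i) failures = Guralnick–Herzig–Tiep type (a): ℓ Fermat, ℓ-solvable image; clause (iv) failures =
eigen-spanning, only for a constituent of dimension ≥ ℓ, i.e. the LOW range ℓ ≤ n, n ≥ 3 [corpus:paper:arxiv-1311.1786 p3 Thm 1.2]; reducible layers).
sorries ONLY inside `stub_*`. -/

set_option linter.dupNamespace false

namespace Summit.Langlands.Langlands.Cruxes.DegenerateLayerLifting.Birth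

open Filter

open Summit.Langlands.Langlands.Theses.LieDefectSplit (DegenerateLayerLifting)

/-- SLAB stub: ℓ ∣ n.  Here ¬SQAL (indeed ¬ quasi-adequacy of EVERY subgroup) is automatic — node `not_solvablyQuasiAdequateImage_of_natCast_eq_zero` —
so the stub is RSL's slab row verbatim (= g11 `stub_slabLifting` up to the redundant dial literal).  Engines would need Thorne's extended adequacy
(2017) / GHT 2017 degree-ℓ theory re-typed in the tree; none.  Dark (residual row); (2,2) is the dyadic world of MinimalLevelDescent. -/
theorem stub_deg_slab : ∀ (K : Type) [Field K] [NumberField K] (n : ℕ) (hcpt : Literature.NumberTheory.Automorphic.isCompact_glFiniteIntegralLevel n K), 0 < n → Summit.Langlands.Langlands.Theorems.CoreAdequacy.LiftBelow n → ∀ (ℓ : ℕ) [Fact ℓ.Prime] (ι : PadicAlgCl ℓ ≃+* ℂ) (ρ : Literature.NumberTheory.GaloisRepresentations.FramedGaloisRep K (PadicAlgCl ℓ) n), ℓ < 2 * (n + 1) → ℓ ∣ n → Summit.Langlands.Langlands.Theorems.CoreAdequacy.CycIrr ρ → ¬ Summit.Langlands.Langlands.Theorems.CoreAdequacy.AdequateCyclotomicImage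 ρ → ¬ Summit.Langlands.Langlands.Theorems.CoreAdequacy.SolvablyAdequateImage ρ → ¬ (∃ (K₀ : Type) (_ : Field K₀) (_ : NumberField K₀) (_ : Algebra K₀ K), IsGalois K₀ K ∧ IsSolvable (K ≃ₐ[K₀] K) ∧ ∃ (ρ₀ : Literature.NumberTheory.GaloisRepresentations.FramedGaloisRep K₀ (PadicAlgCl ℓ) n) (χ : Literature.NumberTheory.GaloisRepresentations.FramedGaloisRep K (PadicAlgCl ℓ) 1), ρ₀.toGaloisRep.IsIrreducible ∧ ((∀ᶠ v : IsDedekindDomain.HeightOneSpectrum (NumberField.RingOfIntegers K₀) in cofinite, ρ₀.IsUnramifiedAt v) ∧ ∀ (v : IsDedekindDomain.HeightOneSpectrum (NumberField.RingOfIntegers K₀)) (hv : ((ℓ : ℕ) : NumberField.RingOfIntegers K₀) ∈ v.asIdeal), (Literature.NumberTheory.PAdicHodge.fontainePstAdicCompletion v ℓ hv).IsDeRhamFramed (ρ₀.toLocal v)) ∧ ((∀ᶠ v : IsDedekindDomain.HeightOneSpectrum (NumberField.RingOfIntegers K) in cofinite, χ.IsUnramifiedAt v) ∧ ∀ (v :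 IsDedekindDomain.HeightOneSpectrum (NumberField.RingOfIntegers K)) (hv : ((ℓ : ℕ) : NumberField.RingOfIntegers K) ∈ v.asIdeal), (Literature.NumberTheory.PAdicHodge.fontainePstAdicCompletion v ℓ hv).IsDeRhamFramed (χ.toLocal v)) ∧ Summit.Langlands.Langlands.Theorems.CoreAdequacy.CycIrr ρ₀ ∧ (Summit.Langlands.Langlands.Theorems.CoreAdequacy.AdequateCyclotomicImage ρ₀ ∨ Summit.Langlands.Langlands.Theorems.CoreAdequacy.SolvablyAdequateImage ρ₀) ∧ ∀ g : Field.absoluteGaloisGroup K, Literature.NumberTheory.GaloisRepresentations.FramedRep.trace ρ g = Literature.NumberTheory.GaloisRepresentations.FramedRep.trace χ g * Literature.NumberTheory.GaloisRepresentations.FramedRep.trace (ρ₀.restrictField K) g) → ¬ (∃ τ : Field.absoluteGaloisGroup (CyclotomicField ℓ K) →* Matrix.GeneralLinearGroup (Fin n) (Literature.NumberTheory.GaloisRepresentations.padicAlgClResidueField ℓ), (ρ.restrictField (CyclotomicField ℓ K)).IsReductionOf (RingHom.id (Literature.NumberTheory.GaloisRepresentations.padicAlgClResidueField ℓ)) τ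 ∧ Literature.NumberTheory.GaloisRepresentations.IsAbsIrreducible τ ∧ ∃ J : Subgroup (Matrix.GeneralLinearGroup (Fin n) (Literature.NumberTheory.GaloisRepresentations.padicAlgClResidueField ℓ)), (∀ Q : Subgroup (Matrix.GeneralLinearGroup (Fin n) (Literature.NumberTheory.GaloisRepresentations.padicAlgClResidueField ℓ)), Q ≤ τ.range → ⁅Q, Q⁆ = Q → Q ≤ J) ∧ J ≤ τ.range ∧ Literature.NumberTheory.GaloisRepresentations.IsAbsIrreducible J.subtype ∧ (∀ f : Additive J →+ Literature.NumberTheory.GaloisRepresentations.padicAlgClResidueField ℓ, f = 0) ∧ (Literature.NumberTheory.GaloisRepresentations.Subgroup.adZeroRep J).invariants = ⊥ ∧ ∀ W : Subrepresentation (Literature.NumberTheory.GaloisRepresentations.Subgroup.adZeroRep J), IsAtom W → ∃ h : J, (orderOf h.1).Coprime (ringChar (Literature.NumberTheory.GaloisRepresentations.padicAlgClResidueField ℓ)) ∧ ∃ α : Literature.NumberTheory.GaloisRepresentations.padicAlgClResidueField ℓ, ∃ w ∈ W, (Literature.NumberTheory.GaloisRepresentations.eigenprojectionMatrix (h.1 :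 Matrix (Fin n) (Fin n) (Literature.NumberTheory.GaloisRepresentations.padicAlgClResidueField ℓ)) α * w.1).trace ≠ 0) → ¬ Summit.Langlands.Langlands.Theorems.BrightMate.SolvablyReducible ρ → ¬ Summit.Langlands.Langlands.Theorems.BrightMate.SolvablyMated ι ρ → Summit.Langlands.Langlands.Theorems.CoreAdequacy.LiftTail K n hcpt ℓ ι ρ := by
  sorry

/-- COPRIME-DEGENERATE stub: ℓ ∤ n and no quasi-adequate absolutely irreducible layer above the perfect core: (i) fails (ℓ-power quotient on every
layer: GHT15 type (a), ℓ = 2^k+1 Fermat, I ℓ-solvable — e.g. ℓ = 3, 5, 17) or (iv) fails (some I⁺-constituent of dimension ≥ ℓ: LOW range ℓ ≤ n, n ≥ 3;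
Guralnick's non-weakly-adequate examples) or every layer above the core is reducible.  No engine; INSTRUMENTABLE by the census GAP table (n ≤ 4). -/
theorem stub_deg_coprime : ∀ (K : Type) [Field K] [NumberField K] (n : ℕ) (hcpt : Literature.NumberTheory.Automorphic.isCompact_glFiniteIntegralLevel n K), 0 < n → Summit.Langlands.Langlands.Theorems.CoreAdequacy.LiftBelow n → ∀ (ℓ : ℕ) [Fact ℓ.Prime] (ι : PadicAlgCl ℓ ≃+* ℂ) (ρ : Literature.NumberTheory.GaloisRepresentations.FramedGaloisRep K (PadicAlgCl ℓ) n), ℓ < 2 * (n + 1) → ¬ ℓ ∣ n → Summit.Langlands.Langlands.Theorems.CoreAdequacy.CycIrr ρ → ¬ Summit.Langlands.Langlands.Theorems.CoreAdequacy.AdequateCyclotomicImage ρ → ¬ Summit.Langlands.Langlands.Theorems.CoreAdequacy.SolvablyAdequateImage ρ → ¬ (∃ (K₀ : Type) (_ : Field K₀) (_ : NumberField K₀) (_ : Algebra K₀ K), IsGalois K₀ K ∧ IsSolvable (K ≃ₐ[K₀] K) ∧ ∃ (ρ₀ : Literature.NumberTheory.GaloisRepresentations.FramedGaloisRep K₀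 (PadicAlgCl ℓ) n) (χ : Literature.NumberTheory.GaloisRepresentations.FramedGaloisRep K (PadicAlgCl ℓ) 1), ρ₀.toGaloisRep.IsIrreducible ∧ ((∀ᶠ v : IsDedekindDomain.HeightOneSpectrum (NumberField.RingOfIntegers K₀) in cofinite, ρ₀.IsUnramifiedAt v) ∧ ∀ (v : IsDedekindDomain.HeightOneSpectrum (NumberField.RingOfIntegers K₀)) (hv : ((ℓ : ℕ) : NumberField.RingOfIntegers K₀) ∈ v.asIdeal), (Literature.NumberTheory.PAdicHodge.fontainePstAdicCompletion v ℓ hv).IsDeRhamFramed (ρ₀.toLocal v)) ∧ ((∀ᶠ v : IsDedekindDomain.HeightOneSpectrum (NumberField.RingOfIntegers K) in cofinite, χ.IsUnramifiedAt v) ∧ ∀ (v : IsDedekindDomain.HeightOneSpectrum (NumberField.RingOfIntegers K)) (hv : ((ℓ : ℕ) : NumberField.RingOfIntegers K) ∈ v.asIdeal), (Literature.NumberTheory.PAdicHodge.fontainePstAdicCompletion v ℓ hv).IsDeRhamFramed (χ.toLocal v)) ∧ Summit.Langlands.Langlands.Theorems.CoreAdequacy.CycIrr ρ₀ ∧ (Summit.Langlands.Langlands.Theorems.CoreAdequacy.AdequateCyclotomicImage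 ρ₀ ∨ Summit.Langlands.Langlands.Theorems.CoreAdequacy.SolvablyAdequateImage ρ₀) ∧ ∀ g : Field.absoluteGaloisGroup K, Literature.NumberTheory.GaloisRepresentations.FramedRep.trace ρ g = Literature.NumberTheory.GaloisRepresentations.FramedRep.trace χ g * Literature.NumberTheory.GaloisRepresentations.FramedRep.trace (ρ₀.restrictField K) g) → ¬ (∃ τ : Field.absoluteGaloisGroup (CyclotomicField ℓ K) →* Matrix.GeneralLinearGroup (Fin n) (Literature.NumberTheory.GaloisRepresentations.padicAlgClResidueField ℓ), (ρ.restrictField (CyclotomicField ℓ K)).IsReductionOf (RingHom.id (Literature.NumberTheory.GaloisRepresentations.padicAlgClResidueField ℓ)) τ ∧ Literature.NumberTheory.GaloisRepresentations.IsAbsIrreducible τ ∧ ∃ J : Subgroup (Matrix.GeneralLinearGroup (Fin n) (Literature.NumberTheory.GaloisRepresentations.padicAlgClResidueField ℓ)), (∀ Q : Subgroup (Matrix.GeneralLinearGroup (Fin n) (Literature.NumberTheory.GaloisRepresentations.padicAlgClResidueField ℓ)), Q ≤ τ.range → ⁅Q, Q⁆ = Q → Q ≤ J) ∧ J ≤ τ.range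 ∧ Literature.NumberTheory.GaloisRepresentations.IsAbsIrreducible J.subtype ∧ (∀ f : Additive J →+ Literature.NumberTheory.GaloisRepresentations.padicAlgClResidueField ℓ, f = 0) ∧ (Literature.NumberTheory.GaloisRepresentations.Subgroup.adZeroRep J).invariants = ⊥ ∧ ∀ W : Subrepresentation (Literature.NumberTheory.GaloisRepresentations.Subgroup.adZeroRep J), IsAtom W → ∃ h : J, (orderOf h.1).Coprime (ringChar (Literature.NumberTheory.GaloisRepresentations.padicAlgClResidueField ℓ)) ∧ ∃ α : Literature.NumberTheory.GaloisRepresentations.padicAlgClResidueField ℓ, ∃ w ∈ W, (Literature.NumberTheory.GaloisRepresentations.eigenprojectionMatrix (h.1 : Matrix (Fin n) (Fin n) (Literature.NumberTheory.GaloisRepresentations.padicAlgClResidueField ℓ)) α * w.1).trace ≠ 0) → ¬ Summit.Langlands.Langlands.Theorems.BrightMate.SolvablyReducible ρ → ¬ Summit.Langlands.Langlands.Theorems.BrightMate.SolvablyMated ι ρ → Summit.Langlands.Langlands.Theorems.CoreAdequacy.LiftTail K n hcpt ℓ ι ρ := by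
  sorry

/-- The split: SLAB → COPRIME → DEG (case analysis on ℓ ∣ n; no other content). -/
theorem DegenerateLayerLifting_of :
    (∀ (K : Type) [Field K] [NumberField K] (n : ℕ) (hcpt : Literature.NumberTheory.Automorphic.isCompact_glFiniteIntegralLevel n K), 0 < n → Summit.Langlands.Langlands.Theorems.CoreAdequacy.LiftBelow n → ∀ (ℓ : ℕ) [Fact ℓ.Prime] (ι : PadicAlgCl ℓ ≃+* ℂ) (ρ : Literature.NumberTheory.GaloisRepresentations.FramedGaloisRep K (PadicAlgCl ℓ) n), ℓ < 2 * (n + 1) → ℓ ∣ n → Summit.Langlands.Langlands.Theorems.CoreAdequacy.CycIrr ρ → ¬ Summit.Langlands.Langlands.Theorems.CoreAdequacy.AdequateCyclotomicImage ρ → ¬ Summit.Langlands.Langlands.Theorems.CoreAdequacy.SolvablyAdequateImage ρ → ¬ (∃ (K₀ : Type) (_ : Field K₀) (_ : NumberField K₀) (_ : Algebra K₀ K), IsGalois K₀ K ∧ IsSolvable (K ≃ₐ[K₀] K) ∧ ∃ (ρ₀ : Literature.NumberTheory.GaloisRepresentations.FramedGaloisRep K₀ (PadicAlgCl ℓ)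 n) (χ : Literature.NumberTheory.GaloisRepresentations.FramedGaloisRep K (PadicAlgCl ℓ) 1), ρ₀.toGaloisRep.IsIrreducible ∧ ((∀ᶠ v : IsDedekindDomain.HeightOneSpectrum (NumberField.RingOfIntegers K₀) in cofinite, ρ₀.IsUnramifiedAt v) ∧ ∀ (v : IsDedekindDomain.HeightOneSpectrum (NumberField.RingOfIntegers K₀)) (hv : ((ℓ : ℕ) : NumberField.RingOfIntegers K₀) ∈ v.asIdeal), (Literature.NumberTheory.PAdicHodge.fontainePstAdicCompletion v ℓ hv).IsDeRhamFramed (ρ₀.toLocal v)) ∧ ((∀ᶠ v : IsDedekindDomain.HeightOneSpectrum (NumberField.RingOfIntegers K) in cofinite, χ.IsUnramifiedAt v) ∧ ∀ (v : IsDedekindDomain.HeightOneSpectrum (NumberField.RingOfIntegers K)) (hv : ((ℓ : ℕ) : NumberField.RingOfIntegers K) ∈ v.asIdeal), (Literature.NumberTheory.PAdicHodge.fontainePstAdicCompletion v ℓ hv).IsDeRhamFramed (χ.toLocal v)) ∧ Summit.Langlands.Langlands.Theorems.CoreAdequacy.CycIrr ρ₀ ∧ (Summit.Langlands.Langlands.Theorems.CoreAdequacy.AdequateCyclotomicImage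 ρ₀ ∨ Summit.Langlands.Langlands.Theorems.CoreAdequacy.SolvablyAdequateImage ρ₀) ∧ ∀ g : Field.absoluteGaloisGroup K, Literature.NumberTheory.GaloisRepresentations.FramedRep.trace ρ g = Literature.NumberTheory.GaloisRepresentations.FramedRep.trace χ g * Literature.NumberTheory.GaloisRepresentations.FramedRep.trace (ρ₀.restrictField K) g) → ¬ (∃ τ : Field.absoluteGaloisGroup (CyclotomicField ℓ K) →* Matrix.GeneralLinearGroup (Fin n) (Literature.NumberTheory.GaloisRepresentations.padicAlgClResidueField ℓ), (ρ.restrictField (CyclotomicField ℓ K)).IsReductionOf (RingHom.id (Literature.NumberTheory.GaloisRepresentations.padicAlgClResidueField ℓ)) τ ∧ Literature.NumberTheory.GaloisRepresentations.IsAbsIrreducible τ ∧ ∃ J : Subgroup (Matrix.GeneralLinearGroup (Fin n) (Literature.NumberTheory.GaloisRepresentations.padicAlgClResidueField ℓ)), (∀ Q : Subgroup (Matrix.GeneralLinearGroup (Fin n) (Literature.NumberTheory.GaloisRepresentations.padicAlgClResidueField ℓ)), Q ≤ τ.range → ⁅Q, Q⁆ = Q → Q ≤ J) ∧ J ≤ τ.range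 ∧ Literature.NumberTheory.GaloisRepresentations.IsAbsIrreducible J.subtype ∧ (∀ f : Additive J →+ Literature.NumberTheory.GaloisRepresentations.padicAlgClResidueField ℓ, f = 0) ∧ (Literature.NumberTheory.GaloisRepresentations.Subgroup.adZeroRep J).invariants = ⊥ ∧ ∀ W : Subrepresentation (Literature.NumberTheory.GaloisRepresentations.Subgroup.adZeroRep J), IsAtom W → ∃ h : J, (orderOf h.1).Coprime (ringChar (Literature.NumberTheory.GaloisRepresentations.padicAlgClResidueField ℓ)) ∧ ∃ α : Literature.NumberTheory.GaloisRepresentations.padicAlgClResidueField ℓ, ∃ w ∈ W, (Literature.NumberTheory.GaloisRepresentations.eigenprojectionMatrix (h.1 : Matrix (Fin n) (Fin n) (Literature.NumberTheory.GaloisRepresentations.padicAlgClResidueField ℓ)) α * w.1).trace ≠ 0) → ¬ Summit.Langlands.Langlands.Theorems.BrightMate.SolvablyReducible ρ → ¬ Summit.Langlands.Langlands.Theorems.BrightMate.SolvablyMated ι ρ → Summit.Langlands.Langlands.Theorems.CoreAdequacy.LiftTail K n hcpt ℓ ι ρ) →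
    (∀ (K : Type) [Field K] [NumberField K] (n : ℕ) (hcpt : Literature.NumberTheory.Automorphic.isCompact_glFiniteIntegralLevel n K), 0 < n → Summit.Langlands.Langlands.Theorems.CoreAdequacy.LiftBelow n → ∀ (ℓ : ℕ) [Fact ℓ.Prime] (ι : PadicAlgCl ℓ ≃+* ℂ) (ρ : Literature.NumberTheory.GaloisRepresentations.FramedGaloisRep K (PadicAlgCl ℓ) n), ℓ < 2 * (n + 1) → ¬ ℓ ∣ n → Summit.Langlands.Langlands.Theorems.CoreAdequacy.CycIrr ρ → ¬ Summit.Langlands.Langlands.Theorems.CoreAdequacy.AdequateCyclotomicImage ρ → ¬ Summit.Langlands.Langlands.Theorems.CoreAdequacy.SolvablyAdequateImage ρ → ¬ (∃ (K₀ : Type) (_ : Field K₀) (_ : NumberField K₀) (_ : Algebra K₀ K), IsGalois K₀ K ∧ IsSolvable (K ≃ₐ[K₀] K) ∧ ∃ (ρ₀ : Literature.NumberTheory.GaloisRepresentations.FramedGaloisRep K₀ (PadicAlgCl ℓ) n) (χ : Literature.NumberTheory.GaloisRepresentations.FramedGaloisRep K (PadicAlgCl ℓ) 1), ρ₀.toGaloisRep.IsIrreducible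 ∧ ((∀ᶠ v : IsDedekindDomain.HeightOneSpectrum (NumberField.RingOfIntegers K₀) in cofinite, ρ₀.IsUnramifiedAt v) ∧ ∀ (v : IsDedekindDomain.HeightOneSpectrum (NumberField.RingOfIntegers K₀)) (hv : ((ℓ : ℕ) : NumberField.RingOfIntegers K₀) ∈ v.asIdeal), (Literature.NumberTheory.PAdicHodge.fontainePstAdicCompletion v ℓ hv).IsDeRhamFramed (ρ₀.toLocal v)) ∧ ((∀ᶠ v : IsDedekindDomain.HeightOneSpectrum (NumberField.RingOfIntegers K) in cofinite, χ.IsUnramifiedAt v) ∧ ∀ (v : IsDedekindDomain.HeightOneSpectrum (NumberField.RingOfIntegers K)) (hv : ((ℓ : ℕ) : NumberField.RingOfIntegers K) ∈ v.asIdeal), (Literature.NumberTheory.PAdicHodge.fontainePstAdicCompletion v ℓ hv).IsDeRhamFramed (χ.toLocal v)) ∧ Summit.Langlands.Langlands.Theorems.CoreAdequacy.CycIrr ρ₀ ∧ (Summit.Langlands.Langlands.Theorems.CoreAdequacy.AdequateCyclotomicImage ρ₀ ∨ Summit.Langlands.Langlands.Theorems.CoreAdequacy.SolvablyAdequateImage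 ρ₀) ∧ ∀ g : Field.absoluteGaloisGroup K, Literature.NumberTheory.GaloisRepresentations.FramedRep.trace ρ g = Literature.NumberTheory.GaloisRepresentations.FramedRep.trace χ g * Literature.NumberTheory.GaloisRepresentations.FramedRep.trace (ρ₀.restrictField K) g) → ¬ (∃ τ : Field.absoluteGaloisGroup (CyclotomicField ℓ K) →* Matrix.GeneralLinearGroup (Fin n) (Literature.NumberTheory.GaloisRepresentations.padicAlgClResidueField ℓ), (ρ.restrictField (CyclotomicField ℓ K)).IsReductionOf (RingHom.id (Literature.NumberTheory.GaloisRepresentations.padicAlgClResidueField ℓ)) τ ∧ Literature.NumberTheory.GaloisRepresentations.IsAbsIrreducible τ ∧ ∃ J : Subgroup (Matrix.GeneralLinearGroup (Fin n) (Literature.NumberTheory.GaloisRepresentations.padicAlgClResidueField ℓ)), (∀ Q : Subgroup (Matrix.GeneralLinearGroup (Fin n) (Literature.NumberTheory.GaloisRepresentations.padicAlgClResidueField ℓ)), Q ≤ τ.range → ⁅Q, Q⁆ = Q → Q ≤ J) ∧ J ≤ τ.range ∧ Literature.NumberTheory.GaloisRepresentations.IsAbsIrreducible J.subtype ∧ (∀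 f : Additive J →+ Literature.NumberTheory.GaloisRepresentations.padicAlgClResidueField ℓ, f = 0) ∧ (Literature.NumberTheory.GaloisRepresentations.Subgroup.adZeroRep J).invariants = ⊥ ∧ ∀ W : Subrepresentation (Literature.NumberTheory.GaloisRepresentations.Subgroup.adZeroRep J), IsAtom W → ∃ h : J, (orderOf h.1).Coprime (ringChar (Literature.NumberTheory.GaloisRepresentations.padicAlgClResidueField ℓ)) ∧ ∃ α : Literature.NumberTheory.GaloisRepresentations.padicAlgClResidueField ℓ, ∃ w ∈ W, (Literature.NumberTheory.GaloisRepresentations.eigenprojectionMatrix (h.1 : Matrix (Fin n) (Fin n) (Literature.NumberTheory.GaloisRepresentations.padicAlgClResidueField ℓ)) α * w.1).trace ≠ 0) → ¬ Summit.Langlands.Langlands.Theorems.BrightMate.SolvablyReducible ρ → ¬ Summit.Langlands.Langlands.Theorems.BrightMate.SolvablyMated ι ρ → Summit.Langlands.Langlands.Theorems.CoreAdequacy.LiftTail K n hcpt ℓ ι ρ) →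
    DegenerateLayerLifting := by
  intro hS hC K _ _ n hcpt hn ih ℓ _ ι ρ hlt
  by_cases hdvd : ℓ ∣ n
  · exact hS K n hcpt hn ih ℓ ι ρ hlt hdvd
  · exact hC K n hcpt hn ih ℓ ι ρ hlt hdvd

/-- DEG from its registered stubs. -/
theorem DegenerateLayerLifting_proof : Summit.Langlands.Langlands.Theses.LieDefectSplit.DegenerateLayerLifting :=
  DegenerateLayerLifting_of stub_deg_slab stub_deg_coprime

end Summit.Langlands.Langlands.Cruxes.DegenerateLayerLifting.Birth
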